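import Summits.NavierStokesRegularity.NavierStokesRegularity.Theorems.RecurrentProfilesRecurrentLiouvilleFrCore
import Summits.NavierStokesRegularity.NavierStokesRegularity.Theorems.RecurrentProfilesRecurrentLiouvilleFrOrbitModulus
import Summits.NavierStokesRegularity.NavierStokesRegularity.Theorems.RecurrentProfilesRecurrentLiouvilleFrEpochRemoval
import Summits.NavierStokesRegularity.NavierStokesRegularity.Theorems.RecurrentProfilesRecurrentLiouvilleFrNoInvariantClusterPoint
import Literature.Analysis.FluidPDE.LocalTypeIScaling
import Literature.Analysis.FluidPDE.SelfSimilar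
import HarnessLib

/-!
# Crux `RecurrentLiouville` (stmt-NavierStokesRegularity-1589), line `Sketch` v7 — the harvest
# (lead c9): epoch form of fast recurrence removal; no convergent scaling orbit (Chae rung)

Theorems-only file (no definitions, no named facts).  The class: suitable weak solutions `(u, p)` of
Navier–Stokes (`ν = 1`, `f = 0`) on the backward slab `ℝ³ × ℝ₋` with weak gradient `G`,
Albritton–Barker quantity `𝐈` and the Type-I rate `C`; scaling orbit `σ ↦ u_{e^σ}`,
`u_c(t,x) = c u(c²t, cx)`; "regular" = `¬ IsBackwardSingularPoint u 0`.

* `fr_epochFastRecurrenceRemoval` — **epoch form of fast recurrence removal**: `∃ L, E, δ > 0`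
  (depending on `C`, `M`) such that a class member whose scaling orbit returns `δ`-close to it in
  `L³(Q(0,1))` within every window `[a, a + L]` for all `a` in ONE epoch `[A, A + E]` of log-scales is
  regular — the landed core `frCore_epoch_of_modulus_of_epochRemoval` (p147803) fed with the landed
  stubs S1 `stub_frOrbitModulus` (p148482) and S2 `stub_frEpochRemoval` (p147959, which rests on the
  window increment removal of skeleton v6, p142120).  Portrait: `fr_epochSlowRecurrence_of_singular` —
  a Type-I singularity model recurs slowly in EVERY epoch of scales.
* `fr_noConvergentOrbit_atTop` / `fr_noConvergentOrbit_atBot` (and the filter form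
  `fr_noConvergentOrbit_of_filter`) — **the scaling orbit of a Type-I singularity model converges in
  neither direction** in `L³_loc` (no unique blow-down; no unique tangent flow / no asymptotically
  self-similar blow-up: Chae, Math. Ann. 338 (2007) Thm 1.5, here in the decay-free suitable weak
  class): a full limit of the orbit is a.e. scale invariant (exact scaling law + uniqueness of
  `L³_loc` limits), so the landed Chae rung S3 `stub_frNoInvariantClusterPoint` (p148324) applies;
  `fr_zero_not_clusterPoint`: in particular `0` is not an `L³_loc` cluster point of the orbit.
* `stub_frHarvest` — registered harvest stub (conjunction of the epoch form and the `atBot` clause).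

## References

* D. Chae, Math. Ann. 338 (2007) 435–449 = arXiv:math/0604234, Thm 1.5. [Chae2007]
* T.-P. Tsai, Arch. Rational Mech. Anal. 143 (1998), Thm 1. [Tsai1998]
* D. Albritton, T. Barker, J. Math. Fluid Mech. 21 (2019), Lemma 2.2, Prop. 2.3, §3. [AlbrittonBarker2019]
-/

noncomputable section

-- the sub-problem namespace repeats the summit name (D-0017 layout `Summit.<S>.<P>.Theorems`)
set_option linter.dupNamespace false

namespace Summit.NavierStokesRegularity.NavierStokesRegularity.Theorems

open MeasureTheory Set Function Filter Topology TopologicalSpace Metric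
open Literature.Analysis Literature.Analysis.FluidPDE
open scoped NNReal ENNReal

/-! ### Epoch form of fast recurrence removal -/

/-- **Epoch form of fast recurrence removal.**  For every rate `C` and bound `M < ⊤` there are
`L > 0`, `E > 0`, `δ > 0` such that a class member whose scaling orbit returns `δ`-close to it in
`L³(Q(0,1))` within every window `[a, a + L]`, for all `a` in ONE epoch `[A, A + E]` of log-scales,
is regular at the origin (`frCore_epoch_of_modulus_of_epochRemoval` with S1 and S2).
[cite: AlbrittonBarker2019, Lemma 2.2, Prop. 2.3; Tsai1998, Thm 1] -/
theorem fr_epochFastRecurrenceRemoval :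
    ∀ (C : ℝ) (M : ℝ≥0∞), M < ⊤ → ∃ L : ℝ, 0 < L ∧ ∃ E : ℝ, 0 < E ∧ ∃ δ : ℝ, 0 < δ ∧
      ∀ (u : ℝ → EuclideanSpace ℝ (Fin 3) → EuclideanSpace ℝ (Fin 3))
        (p : ℝ → EuclideanSpace ℝ (Fin 3) → ℝ)
        (G : ℝ → EuclideanSpace ℝ (Fin 3) → EuclideanSpace ℝ (Fin 3) →L[ℝ] EuclideanSpace ℝ (Fin 3)),
        IsSuitableWeakSolutionOn (slab (EuclideanSpace ℝ (Fin 3)) (Iio 0) isOpen_Iio) 1 0 u p →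
        HasWeakSpatialGradientOn (slab (EuclideanSpace ℝ (Fin 3)) (Iio 0) isOpen_Iio) u G →
        typeIBound (Iio (0 : ℝ) ×ˢ univ) u p G ≤ M →
        HasTypeITimeDecay C u →
        (∃ A : ℝ, ∀ a ∈ Icc A (A + E), ∃ σ ∈ Icc a (a + L),
          eLpNorm (uncurry (nsRescale (Real.exp σ) u) - uncurry u) 3
            (volume.restrict (parabolicCylinder 1 (0 : ℝ × EuclideanSpace ℝ (Fin 3)))) ≤
              ENNReal.ofReal δ) →
        ¬ IsBackwardSingularPoint u 0 :=
  frCore_epoch_of_modulus_of_epochRemoval stub_frOrbitModulus stub_frEpochRemoval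

/-- **Portrait clause (epoch form): a Type-I singularity model recurs slowly in EVERY epoch.**  For
every rate `C` and bound `M < ⊤` there are `L, E, δ > 0` such that for every origin-singular class
member and EVERY `A` some window `[a, a + L]` with `a ∈ [A, A + E]` is free of `δ`-returns of the
scaling orbit in `L³(Q(0,1))`. [cite: AlbrittonBarker2019, Prop. 2.3] -/
theorem fr_epochSlowRecurrence_of_singular :
    ∀ (C : ℝ) (M : ℝ≥0∞), M < ⊤ → ∃ L : ℝ, 0 < L ∧ ∃ E : ℝ, 0 < E ∧ ∃ δ : ℝ, 0 < δ ∧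
      ∀ (u : ℝ → EuclideanSpace ℝ (Fin 3) → EuclideanSpace ℝ (Fin 3))
        (p : ℝ → EuclideanSpace ℝ (Fin 3) → ℝ)
        (G : ℝ → EuclideanSpace ℝ (Fin 3) → EuclideanSpace ℝ (Fin 3) →L[ℝ] EuclideanSpace ℝ (Fin 3)),
        IsSuitableWeakSolutionOn (slab (EuclideanSpace ℝ (Fin 3)) (Iio 0) isOpen_Iio) 1 0 u p →
        HasWeakSpatialGradientOn (slab (EuclideanSpace ℝ (Fin 3)) (Iio 0) isOpen_Iio) u G →
        typeIBound (Iio (0 : ℝ) ×ˢ univ) u p G ≤ M →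
        HasTypeITimeDecay C u →
        IsBackwardSingularPoint u 0 →
        ∀ A : ℝ, ∃ a ∈ Icc A (A + E), ∀ σ ∈ Icc a (a + L),
          ENNReal.ofReal δ <
            eLpNorm (uncurry (nsRescale (Real.exp σ) u) - uncurry u) 3
              (volume.restrict (parabolicCylinder 1 (0 : ℝ × EuclideanSpace ℝ (Fin 3)))) := by
  intro C M hM
  obtain ⟨L, hL, E, hE, δ, hδ, hrem⟩ := fr_epochFastRecurrenceRemoval C M hM
  refine ⟨L, hL, E, hE, δ, hδ, fun u p G hsw hwg hI hdec hsing A => ?_⟩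
  by_contra h
  push Not at h
  exact hrem u p G hsw hwg hI hdec ⟨A, h⟩ hsing

/-! ### No convergent scaling orbit (from the Chae rung S3) -/

/-- Measurability of the zooms of a field measurable on every backward ball about the origin.
[folklore] -/
theorem frHarvest_aestronglyMeasurable_nsRescale {w : ℝ → EuclideanSpace ℝ (Fin 3) → EuclideanSpace ℝ (Fin 3)}
    (hwm : ∀ R : ℝ, 0 < R → AEStronglyMeasurable (uncurry w)
      (volume.restrict (parabolicCylinder R (0 : ℝ × EuclideanSpace ℝ (Fin 3)))))
    {c : ℝ} (hc : 0 < c) {R : ℝ} (hR : 0 < R) :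
    AEStronglyMeasurable (uncurry (nsRescale c w))
      (volume.restrict (parabolicCylinder R (0 : ℝ × EuclideanSpace ℝ (Fin 3)))) := by
  have e : uncurry (nsRescale c w) = c • (uncurry w ∘ stAffine (c ^ 2) c (0 : ℝ) (0 : EuclideanSpace ℝ (Fin 3))) := by
    funext z
    simp only [uncurry, Pi.smul_apply, comp_apply, nsRescale_apply, stAffine_fst, stAffine_snd, zero_add]
  rw [e]
  refine AEStronglyMeasurable.const_smul ?_ c
  have hpre : stAffine (c ^ 2) c 0 (0 : EuclideanSpace ℝ (Fin 3)) ⁻¹' parabolicCylinder (c * R) 0 =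
      parabolicCylinder R (0 : ℝ × EuclideanSpace ℝ (Fin 3)) := by
    rw [stAffine_preimage_parabolicCylinder_zero hc, mul_div_cancel_left₀ R hc.ne']
  rw [← hpre]
  refine (hwm (c * R) (by positivity)).comp_quasiMeasurePreserving ⟨measurable_stAffine _ _ _ _, ?_⟩
  rw [map_stAffine_volume_restrict_preimage (pow_pos hc 2) hc]
  exact Measure.smul_absolutelyContinuous

/-- **No convergent scaling orbit along a translation-invariant filter.**  Let `(u, p)` be a class
member (`𝐈 < ⊤`, rate `C`), `l` a filter on the log-scales admitting a sequence and invariant under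
translations (`atTop`, `atBot`), and suppose the scaling orbit converges along `l` in every
`L³(Q(0,R))` to a measurable field `w`.  Then `u` is regular at the origin: the limit of a
translate of the orbit is the corresponding zoom of `w` (exact scaling law), so `w` is a.e. scale
invariant by uniqueness of `L³_loc` limits, and the Chae rung S3 applies along the sequence.
[cite: Chae2007, Thm 1.5; Tsai1998, Thm 1] -/
theorem fr_noConvergentOrbit_of_filter {l : Filter ℝ} (s : ℕ → ℝ) (hs : Tendsto s atTop l)
    (hl : ∀ τ : ℝ, Tendsto (fun σ => σ + τ) l l)
    (C : ℝ) (u : ℝ → EuclideanSpace ℝ (Fin 3) → EuclideanSpace ℝ (Fin 3))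
    (p : ℝ → EuclideanSpace ℝ (Fin 3) → ℝ)
    (G : ℝ → EuclideanSpace ℝ (Fin 3) → EuclideanSpace ℝ (Fin 3) →L[ℝ] EuclideanSpace ℝ (Fin 3))
    (hsw : IsSuitableWeakSolutionOn (slab (EuclideanSpace ℝ (Fin 3)) (Iio 0) isOpen_Iio) 1 0 u p)
    (hwg : HasWeakSpatialGradientOn (slab (EuclideanSpace ℝ (Fin 3)) (Iio 0) isOpen_Iio) u G)
    (hI : typeIBound (Iio (0 : ℝ) ×ˢ univ) u p G < ⊤) (hdec : HasTypeITimeDecay C u)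
    (w : ℝ → EuclideanSpace ℝ (Fin 3) → EuclideanSpace ℝ (Fin 3))
    (hwm : ∀ R : ℝ, 0 < R → AEStronglyMeasurable (uncurry w)
      (volume.restrict (parabolicCylinder R (0 : ℝ × EuclideanSpace ℝ (Fin 3)))))
    (hconv : ∀ R : ℝ, 0 < R → Tendsto (fun σ : ℝ => eLpNorm (uncurry (nsRescale (Real.exp σ) u) - uncurry w) 3
      (volume.restrict (parabolicCylinder R (0 : ℝ × EuclideanSpace ℝ (Fin 3))))) l (𝓝 0)) :
    ¬ IsBackwardSingularPoint u 0 := by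
  refine stub_frNoInvariantClusterPoint C u p G hsw hwg hI hdec (fun n => Real.exp (s n))
    (fun n => Real.exp_pos _) w hwm (fun R hR => (hconv R hR).comp hs) fun τ => ?_
  -- `w_{e^τ}` and `w` are both limits of the translated orbit `u_{e^{s_j + τ}}`
  have hcτ : 0 < Real.exp τ := Real.exp_pos τ
  have hvm : ∀ (n : ℕ) (j : ℕ), AEStronglyMeasurable (uncurry (nsRescale (Real.exp (s j + τ)) u))
      (volume.restrict (parabolicCylinder ((n : ℝ) + 1) (0 : ℝ × EuclideanSpace ℝ (Fin 3)))) := by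
    intro n j
    rw [nsRescale_eq_zoom]
    exact (zoom_slabProfile hsw hwg (Real.exp_pos _)).2.1.locallyIntegrableOn.aestronglyMeasurable.mono_measure
      (Measure.restrict_mono (parabolicCylinder_origin_subset_slab _) le_rfl)
  have hwm1 : ∀ n : ℕ, AEStronglyMeasurable (uncurry (nsRescale (Real.exp τ) w))
      (volume.restrict (parabolicCylinder ((n : ℝ) + 1) (0 : ℝ × EuclideanSpace ℝ (Fin 3)))) :=
    fun n => frHarvest_aestronglyMeasurable_nsRescale hwm hcτ (by positivity)
  have hwm2 : ∀ n : ℕ, AEStronglyMeasurable (uncurry w)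
      (volume.restrict (parabolicCylinder ((n : ℝ) + 1) (0 : ℝ × EuclideanSpace ℝ (Fin 3)))) :=
    fun n => hwm _ (by positivity)
  -- limit 1: the zoom of `w`
  have h1 : ∀ n : ℕ, Tendsto (fun j => eLpNorm (uncurry (nsRescale (Real.exp (s j + τ)) u) -
      uncurry (nsRescale (Real.exp τ) w)) 3
      (volume.restrict (parabolicCylinder ((n : ℝ) + 1) (0 : ℝ × EuclideanSpace ℝ (Fin 3))))) atTop (𝓝 0) := by
    intro n
    have hscale : ∀ j, eLpNorm (uncurry (nsRescale (Real.exp (s j + τ)) u) -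
        uncurry (nsRescale (Real.exp τ) w)) 3
        (volume.restrict (parabolicCylinder ((n : ℝ) + 1) (0 : ℝ × EuclideanSpace ℝ (Fin 3)))) =
        ‖Real.exp τ‖ₑ * (ENNReal.ofReal ((Real.exp τ) ^ 2 * (Real.exp τ) ^ 3)⁻¹) ^ (1 / (3 : ℝ≥0∞).toReal) *
          eLpNorm (uncurry (nsRescale (Real.exp (s j)) u) - uncurry w) 3
            (volume.restrict (parabolicCylinder (Real.exp τ * ((n : ℝ) + 1)) (0 : ℝ × EuclideanSpace ℝ (Fin 3)))) := by
      intro j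
      rw [Real.exp_add, nsRescale_mul, nsRescale_eq_zoom (Real.exp τ) (nsRescale _ u),
        nsRescale_eq_zoom (Real.exp τ) w, eLpNorm_zoom_sub_zoom _ _ hcτ]
    simp_rw [hscale]
    have h := ENNReal.Tendsto.const_mul ((hconv (Real.exp τ * ((n : ℝ) + 1)) (by positivity)).comp hs)
      (Or.inr (zoomConst_ne_top (Real.exp τ)))
    rw [mul_zero] at h
    exact h
  -- limit 2: `w` itself (translation invariance of the filter)
  have h2 : ∀ n : ℕ, Tendsto (fun j => eLpNorm (uncurry (nsRescale (Real.exp (s j + τ)) u) - uncurry w) 3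
      (volume.restrict (parabolicCylinder ((n : ℝ) + 1) (0 : ℝ × EuclideanSpace ℝ (Fin 3))))) atTop (𝓝 0) :=
    fun n => (hconv _ (by positivity)).comp ((hl τ).comp hs)
  have hae := ae_eq_lowerHalf_of_tendsto_eLpNorm hvm hwm1 hwm2 h1 h2
  filter_upwards [hae] with z hz
  exact hz

/-- **The scaling orbit of a Type-I singularity model does not converge as `σ → +∞`** (zoom OUT of
the origin: no unique "blow-down"): if `u_{e^σ} → w` in every `L³(Q(0,R))` as `σ → +∞`, for a
measurable `w`, then `u` is regular at the origin. [cite: Chae2007, Thm 1.5; Tsai1998, Thm 1] -/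
theorem fr_noConvergentOrbit_atTop (C : ℝ) (u : ℝ → EuclideanSpace ℝ (Fin 3) → EuclideanSpace ℝ (Fin 3))
    (p : ℝ → EuclideanSpace ℝ (Fin 3) → ℝ)
    (G : ℝ → EuclideanSpace ℝ (Fin 3) → EuclideanSpace ℝ (Fin 3) →L[ℝ] EuclideanSpace ℝ (Fin 3))
    (hsw : IsSuitableWeakSolutionOn (slab (EuclideanSpace ℝ (Fin 3)) (Iio 0) isOpen_Iio) 1 0 u p)
    (hwg : HasWeakSpatialGradientOn (slab (EuclideanSpace ℝ (Fin 3)) (Iio 0) isOpen_Iio) u G)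
    (hI : typeIBound (Iio (0 : ℝ) ×ˢ univ) u p G < ⊤) (hdec : HasTypeITimeDecay C u)
    (w : ℝ → EuclideanSpace ℝ (Fin 3) → EuclideanSpace ℝ (Fin 3))
    (hwm : ∀ R : ℝ, 0 < R → AEStronglyMeasurable (uncurry w)
      (volume.restrict (parabolicCylinder R (0 : ℝ × EuclideanSpace ℝ (Fin 3)))))
    (hconv : ∀ R : ℝ, 0 < R → Tendsto (fun σ : ℝ => eLpNorm (uncurry (nsRescale (Real.exp σ) u) - uncurry w) 3
      (volume.restrict (parabolicCylinder R (0 : ℝ × EuclideanSpace ℝ (Fin 3))))) atTop (𝓝 0)) :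
    ¬ IsBackwardSingularPoint u 0 :=
  fr_noConvergentOrbit_of_filter (fun n : ℕ => (n : ℝ)) tendsto_natCast_atTop_atTop
    (fun τ => tendsto_atTop_add_const_right _ τ tendsto_id) C u p G hsw hwg hI hdec w hwm hconv

/-- **The scaling orbit of a Type-I singularity model does not converge as `σ → −∞`** (zoom INTO
the origin: no unique tangent flow / no asymptotically self-similar blow-up, Chae 2007 Thm 1.5 in
the Albritton–Barker class): if `u_{e^σ} → w` in every `L³(Q(0,R))` as `σ → −∞`, for a measurable
`w`, then `u` is regular at the origin. [cite: Chae2007, Thm 1.5; Tsai1998, Thm 1] -/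
theorem fr_noConvergentOrbit_atBot (C : ℝ) (u : ℝ → EuclideanSpace ℝ (Fin 3) → EuclideanSpace ℝ (Fin 3))
    (p : ℝ → EuclideanSpace ℝ (Fin 3) → ℝ)
    (G : ℝ → EuclideanSpace ℝ (Fin 3) → EuclideanSpace ℝ (Fin 3) →L[ℝ] EuclideanSpace ℝ (Fin 3))
    (hsw : IsSuitableWeakSolutionOn (slab (EuclideanSpace ℝ (Fin 3)) (Iio 0) isOpen_Iio) 1 0 u p)
    (hwg : HasWeakSpatialGradientOn (slab (EuclideanSpace ℝ (Fin 3)) (Iio 0) isOpen_Iio) u G)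
    (hI : typeIBound (Iio (0 : ℝ) ×ˢ univ) u p G < ⊤) (hdec : HasTypeITimeDecay C u)
    (w : ℝ → EuclideanSpace ℝ (Fin 3) → EuclideanSpace ℝ (Fin 3))
    (hwm : ∀ R : ℝ, 0 < R → AEStronglyMeasurable (uncurry w)
      (volume.restrict (parabolicCylinder R (0 : ℝ × EuclideanSpace ℝ (Fin 3)))))
    (hconv : ∀ R : ℝ, 0 < R → Tendsto (fun σ : ℝ => eLpNorm (uncurry (nsRescale (Real.exp σ) u) - uncurry w) 3
      (volume.restrict (parabolicCylinder R (0 : ℝ × EuclideanSpace ℝ (Fin 3))))) atBot (𝓝 0)) :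
    ¬ IsBackwardSingularPoint u 0 :=
  fr_noConvergentOrbit_of_filter (fun n : ℕ => -(n : ℝ))
    (tendsto_neg_atTop_atBot.comp tendsto_natCast_atTop_atTop)
    (fun τ => tendsto_atBot_add_const_right _ τ tendsto_id) C u p G hsw hwg hI hdec w hwm hconv


/-- **`0` is not an `L³_loc` cluster point of the scaling orbit of a Type-I singularity model**: if
`u_{c_n} → 0` in every `L³(Q(0,R))` along scales `c_n > 0`, then `u` is regular at the origin (the
zero field is measurable and scale invariant; S3). [cite: Chae2007, Thm 1.5; Tsai1998, Thm 1] -/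
theorem fr_zero_not_clusterPoint (C : ℝ) (u : ℝ → EuclideanSpace ℝ (Fin 3) → EuclideanSpace ℝ (Fin 3))
    (p : ℝ → EuclideanSpace ℝ (Fin 3) → ℝ)
    (G : ℝ → EuclideanSpace ℝ (Fin 3) → EuclideanSpace ℝ (Fin 3) →L[ℝ] EuclideanSpace ℝ (Fin 3))
    (hsw : IsSuitableWeakSolutionOn (slab (EuclideanSpace ℝ (Fin 3)) (Iio 0) isOpen_Iio) 1 0 u p)
    (hwg : HasWeakSpatialGradientOn (slab (EuclideanSpace ℝ (Fin 3)) (Iio 0) isOpen_Iio) u G)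
    (hI : typeIBound (Iio (0 : ℝ) ×ˢ univ) u p G < ⊤) (hdec : HasTypeITimeDecay C u)
    (c : ℕ → ℝ) (hc : ∀ n, 0 < c n)
    (hconv : ∀ R : ℝ, 0 < R → Tendsto (fun n => eLpNorm (uncurry (nsRescale (c n) u)) 3
      (volume.restrict (parabolicCylinder R (0 : ℝ × EuclideanSpace ℝ (Fin 3))))) atTop (𝓝 0)) :
    ¬ IsBackwardSingularPoint u 0 := by
  refine stub_frNoInvariantClusterPoint C u p G hsw hwg hI hdec c hc 0
    (fun R _ => aestronglyMeasurable_zero) (fun R hR => ?_) (fun σ => Eventually.of_forall fun z => ?_)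
  · simpa only [uncurry_zero, sub_zero] using hconv R hR
  · simp [nsRescale_apply]

/-! ### Registered harvest stub -/

/-- **Registered harvest stub** `stub_frHarvest` (crux stmt-NavierStokesRegularity-1589, line Sketch
v7): the epoch form of fast recurrence removal, and the `σ → −∞` clause of "no convergent scaling
orbit" (no asymptotically self-similar Type-I blow-up in the Albritton–Barker class).
[cite: Chae2007, Thm 1.5; AlbrittonBarker2019, Prop. 2.3] -/
theorem stub_frHarvest :
    (∀ (C : ℝ) (M : ℝ≥0∞), M < ⊤ → ∃ L : ℝ, 0 < L ∧ ∃ E : ℝ, 0 < E ∧ ∃ δ : ℝ, 0 < δ ∧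
      ∀ (u : ℝ → EuclideanSpace ℝ (Fin 3) → EuclideanSpace ℝ (Fin 3))
        (p : ℝ → EuclideanSpace ℝ (Fin 3) → ℝ)
        (G : ℝ → EuclideanSpace ℝ (Fin 3) → EuclideanSpace ℝ (Fin 3) →L[ℝ] EuclideanSpace ℝ (Fin 3)),
        IsSuitableWeakSolutionOn (slab (EuclideanSpace ℝ (Fin 3)) (Iio 0) isOpen_Iio) 1 0 u p →
        HasWeakSpatialGradientOn (slab (EuclideanSpace ℝ (Fin 3)) (Iio 0) isOpen_Iio) u G →
        typeIBound (Iio (0 : ℝ) ×ˢ univ) u p G ≤ M →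
        HasTypeITimeDecay C u →
        (∃ A : ℝ, ∀ a ∈ Icc A (A + E), ∃ σ ∈ Icc a (a + L),
          eLpNorm (uncurry (nsRescale (Real.exp σ) u) - uncurry u) 3
            (volume.restrict (parabolicCylinder 1 (0 : ℝ × EuclideanSpace ℝ (Fin 3)))) ≤
              ENNReal.ofReal δ) →
        ¬ IsBackwardSingularPoint u 0) ∧
    (∀ (C : ℝ) (u : ℝ → EuclideanSpace ℝ (Fin 3) → EuclideanSpace ℝ (Fin 3))
      (p : ℝ → EuclideanSpace ℝ (Fin 3) → ℝ)
      (G : ℝ → EuclideanSpace ℝ (Fin 3) → EuclideanSpace ℝ (Fin 3) →L[ℝ] EuclideanSpace ℝ (Fin 3)),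
      IsSuitableWeakSolutionOn (slab (EuclideanSpace ℝ (Fin 3)) (Iio 0) isOpen_Iio) 1 0 u p →
      HasWeakSpatialGradientOn (slab (EuclideanSpace ℝ (Fin 3)) (Iio 0) isOpen_Iio) u G →
      typeIBound (Iio (0 : ℝ) ×ˢ univ) u p G < ⊤ →
      HasTypeITimeDecay C u →
      ∀ (w : ℝ → EuclideanSpace ℝ (Fin 3) → EuclideanSpace ℝ (Fin 3)),
        (∀ R : ℝ, 0 < R → AEStronglyMeasurable (uncurry w)
          (volume.restrict (parabolicCylinder R (0 : ℝ × EuclideanSpace ℝ (Fin 3))))) →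
        (∀ R : ℝ, 0 < R → Tendsto (fun σ : ℝ =>
            eLpNorm (uncurry (nsRescale (Real.exp σ) u) - uncurry w) 3
              (volume.restrict (parabolicCylinder R (0 : ℝ × EuclideanSpace ℝ (Fin 3))))) atBot (𝓝 0)) →
        ¬ IsBackwardSingularPoint u 0) :=
  ⟨fr_epochFastRecurrenceRemoval, fun C u p G hsw hwg hI hdec w hwm hconv =>
    fr_noConvergentOrbit_atBot C u p G hsw hwg hI hdec w hwm hconv⟩

end Summit.NavierStokesRegularity.NavierStokesRegularity.Theorems

end
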